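import Mathlib
import HarnessLib
import Summits.Ventures.LatticeQCDFlow.Exactness.SphereGeodesicDrift

/-!
# The exact geodesic site update of `cpn_2d` is the exponential of the rotation generator: `x(τ) = e^{τA}x`, `π(τ) = e^{τA}π`, `A = π⊗x − x⊗π`

HONEST FRAMING: exact (Metropolis-corrected) sampling algorithms for lattice gauge theory;
figures of merit are autocorrelation/cost numbers at stated couplings and volumes; no
continuum-physics claim.

Venture `LatticeQCDFlow` (cell pub-lqcd), topic `Exactness`, FANOUT row 9 (eng-latcore, the
engine `latflow.core.cpn_2d.HMCCPN`: the site update of the leapfrog is the EXACT free geodesic step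
`x ← cos(|π|ε) x + sin(|π|ε) π/|π|`, `π ← −|π| sin(|π|ε) x + cos(|π|ε) π` of Engel–Schaefer eq. (11),
typed by row 7 as `geodesicDrift`).  NEW WORK of the cell over Mathlib (`hasDerivAt_exp_smul_const'`,
`HasDerivAt.clm_apply`, `HasDerivAt.scomp`, `is_const_of_deriv_eq_zero`) and the tree
(`SphereGeodesicDrift.lean`, row 7: `geodesicDrift`); nothing is cited as a fact.  Printed
counterpart, NAMED ONLY: Engel–Schaefer, Comput. Phys. Commun. 182 (2011) 2107, eq. (11).

THE POINT (dictionary; the first brick of the body-frame reduction of the sphere leapfrog to the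
kicked-product systems of `KickedProductTrajectory.lean`).  On a real inner product space `V`, for a
unit vector `x` and a tangent momentum `π ⊥ x`, the skew-adjoint rank-two operator
`A = A(x, π) : y ↦ ⟪x, y⟫ π − ⟪π, y⟫ x` (so `A x = π`, `A π = −‖π‖² x`, `A = 0` on `{x, π}ᗮ`) generates the
geodesic: the closed-form drift IS `(e^{τA} x, e^{τA} π)` — the one-parameter group `τ ↦ e^{τA}` of
rotations of `V` applied to BOTH components.  Proof without power series: `y(s) = x(s)` solves
`y' = A y` (the closed form differentiates to `A` of itself), so `u(s) = e^{(τ−s)A} y(s)` has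
derivative zero, is constant, and `y(τ) = u(τ) = u(0) = e^{τA} x`; the momentum is
`y' = A e^{τA} x = e^{τA} A x = e^{τA} π`.

* §1 `geodGen x π` (a continuous linear map), `geodGen_apply`, `geodGen_apply_self` (`A x = π`),
  `geodGen_apply_mom` (`A π = −‖π‖²x`), `geodGen_swap` (`A(π, x) = −A(x, π)`), `inner_geodGen_symm`
  (skew-adjoint).
* §2 `hasDerivAt_geodesicDrift_fst` (`d/dτ x(τ) = π(τ)`), `geodGen_geodesicDrift_fst` (`A x(τ) = π(τ)`).
* §3 **`geodesicDrift_fst_eq_exp`**, **`geodesicDrift_snd_eq_exp`**, **`geodesicDrift_eq_exp`** —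
  `geodesicDrift τ (x, π) = (e^{τA} x, e^{τA} π)` for `‖x‖ = 1`, `⟪x, π⟫ = 0` (`V` complete).

NOT CLAIMED: that `e^{τA}` is an isometry / lies in `SO(V)` as a typed statement (immediate from
skew-adjointness, not needed here); the conjugation rule `A(Wx, Wπ) = W A(x, π) W⁻¹` and the body-frame
form of the `n`-step leapfrog (sequel); matrices (`V = ℝ^m`: `A = π xᵀ − x πᵀ`); anything quantitative.
-/

noncomputable section

namespace Summit.Ventures.LatticeQCDFlow.Exactness

open Real NormedSpace
open scoped InnerProductSpace

variable {V : Type*} [NormedAddCommGroup V] [InnerProductSpace ℝ V]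

/-! ## §1 The rotation generator -/

section Gen

/-- **The rotation generator of the geodesic** through `x` with velocity `π`:
`A(x, π) y = ⟪x, y⟫ π − ⟪π, y⟫ x` (in `ℝ^m`: the matrix `π xᵀ − x πᵀ`). -/
def geodGen (x p : V) : V →L[ℝ] V :=
  (innerSL ℝ x).smulRight p - (innerSL ℝ p).smulRight x

/-- Pointwise. -/
@[simp] theorem geodGen_apply (x p y : V) : geodGen x p y = ⟪x, y⟫_ℝ • p - ⟪p, y⟫_ℝ • x := by
  simp [geodGen]

/-- `A x = π` (`‖x‖ = 1`, `π ⊥ x`). -/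
theorem geodGen_apply_self {x p : V} (hx : ‖x‖ = 1) (hxp : ⟪x, p⟫_ℝ = 0) : geodGen x p x = p := by
  rw [geodGen_apply, real_inner_self_eq_norm_sq, hx, one_pow, one_smul, real_inner_comm, hxp, zero_smul, sub_zero]

/-- `A π = −‖π‖² x` (`π ⊥ x`). -/
theorem geodGen_apply_mom {x p : V} (hxp : ⟪x, p⟫_ℝ = 0) : geodGen x p p = -(‖p‖ ^ 2) • x := by
  rw [geodGen_apply, hxp, zero_smul, zero_sub, real_inner_self_eq_norm_sq, neg_smul]

/-- Antisymmetry in the pair: `A(π, x) = −A(x, π)`. -/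
theorem geodGen_swap (x p : V) : geodGen p x = -geodGen x p := by
  ext y
  show geodGen p x y = -(geodGen x p y)
  simp only [geodGen_apply, neg_sub]

/-- `A` is skew-adjoint: `⟪A y, y'⟫ = −⟪y, A y'⟫`. -/
theorem inner_geodGen_symm (x p y y' : V) : ⟪geodGen x p y, y'⟫_ℝ = -⟪y, geodGen x p y'⟫_ℝ := by
  simp only [geodGen_apply, inner_sub_left, inner_sub_right, real_inner_smul_left, real_inner_smul_right,
    real_inner_comm x y, real_inner_comm p y]
  ring

/-- With zero momentum the generator vanishes. -/
@[simp] theorem geodGen_zero_right (x : V) : geodGen x 0 = 0 := by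
  ext y; simp

end Gen

/-! ## §2 The closed-form geodesic solves `y' = A y` -/

section ODE

variable (x p : V)

/-- `d/dτ x(τ) = π(τ)`: the position component of the closed-form drift differentiates to the momentum
component. -/
theorem hasDerivAt_geodesicDrift_fst (t : ℝ) :
    HasDerivAt (fun s : ℝ => (geodesicDrift s (x, p)).1) (geodesicDrift t (x, p)).2 t := by
  rcases eq_or_ne p 0 with rfl | hp
  · simp only [geodesicDrift, norm_zero, zero_mul, cos_zero, one_smul, smul_zero, add_zero, sin_zero, mul_zero,
      neg_zero, zero_smul]
    exact hasDerivAt_const t x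
  · have hn : ‖p‖ ≠ 0 := norm_ne_zero_iff.2 hp
    have hl : HasDerivAt (fun s : ℝ => ‖p‖ * s) ‖p‖ t := by
      simpa using (hasDerivAt_id t).const_mul ‖p‖
    have hc : HasDerivAt (fun s : ℝ => cos (‖p‖ * s)) (-sin (‖p‖ * t) * ‖p‖) t := hl.cos
    have hs : HasDerivAt (fun s : ℝ => sin (‖p‖ * s) / ‖p‖) (cos (‖p‖ * t) * ‖p‖ / ‖p‖) t := hl.sin.div_const ‖p‖
    have h := (hc.smul_const x).add (hs.smul_const p)
    simp only [geodesicDrift]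
    refine h.congr_deriv ?_
    rw [mul_div_assoc, div_self hn, mul_one, neg_mul, mul_comm (sin (‖p‖ * t)) ‖p‖]

/-- `A x(τ) = π(τ)`: the closed form is an integral curve of the generator (`‖x‖ = 1`, `π ⊥ x`). -/
theorem geodGen_geodesicDrift_fst {x p : V} (hx : ‖x‖ = 1) (hxp : ⟪x, p⟫_ℝ = 0) (t : ℝ) :
    geodGen x p (geodesicDrift t (x, p)).1 = (geodesicDrift t (x, p)).2 := by
  rcases eq_or_ne p 0 with rfl | hp
  · simp [geodesicDrift]
  · have hn : ‖p‖ ≠ 0 := norm_ne_zero_iff.2 hp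
    have key : sin (‖p‖ * t) / ‖p‖ * -(‖p‖ ^ 2) = -(‖p‖ * sin (‖p‖ * t)) := by
      rw [mul_neg, pow_two, ← mul_assoc, div_mul_cancel₀ _ hn, mul_comm]
    simp only [geodesicDrift, map_add, map_smul, geodGen_apply_self hx hxp, geodGen_apply_mom hxp, smul_smul, key]
    rw [add_comm]

end ODE

/-! ## §3 The drift is the exponential of the generator -/

section Exp

variable [CompleteSpace V] {x p : V}

/-- **`x(τ) = e^{τA} x`**: the position component of the exact geodesic drift is the exponential of the
rotation generator applied to the start (`‖x‖ = 1`, `π ⊥ x`).  Proof: `u(s) = e^{(τ−s)A} x(s)` has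
derivative `−A e^{(τ−s)A} x(s) + e^{(τ−s)A} A x(s) = 0`, so `x(τ) = u(τ) = u(0) = e^{τA} x`. -/
theorem geodesicDrift_fst_eq_exp (hx : ‖x‖ = 1) (hxp : ⟪x, p⟫_ℝ = 0) (t : ℝ) :
    (geodesicDrift t (x, p)).1 = exp (t • geodGen x p) x := by
  set A := geodGen x p with hA
  set u : ℝ → V := fun s => exp ((t - s) • A) (geodesicDrift s (x, p)).1 with hu_def
  have hcommE : ∀ r : ℝ, A * exp (r • A) = exp (r • A) * A := fun r =>
    (((Commute.refl A).smul_right r).exp_right).eq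
  have hu : ∀ s, HasDerivAt u 0 s := by
    intro s
    have h1 : HasDerivAt (fun r : ℝ => t - r) (-1) s := by
      simpa using (hasDerivAt_id s).const_sub t
    have hE : HasDerivAt (fun r : ℝ => exp ((t - r) • A)) ((-1 : ℝ) • (A * exp ((t - s) • A))) s :=
      (hasDerivAt_exp_smul_const' (𝕂 := ℝ) A (t - s)).scomp s h1
    have h := hE.clm_apply (hasDerivAt_geodesicDrift_fst x p s)
    refine h.congr_deriv ?_
    rw [← geodGen_geodesicDrift_fst hx hxp s, ← hA, neg_one_smul]
    have key : (exp ((t - s) • A)) (A (geodesicDrift s (x, p)).1) =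
        (A * exp ((t - s) • A)) (geodesicDrift s (x, p)).1 := by
      rw [hcommE]; rfl
    rw [key]
    exact neg_add_cancel _
  have hconst := is_const_of_deriv_eq_zero (fun s => (hu s).differentiableAt) (fun s => (hu s).deriv) t 0
  have hut : u t = (geodesicDrift t (x, p)).1 := by
    show exp ((t - t) • A) (geodesicDrift t (x, p)).1 = _
    rw [sub_self, zero_smul, NormedSpace.exp_zero]
    rfl
  have hu0 : u 0 = exp (t • A) x := by
    show exp ((t - 0) • A) (geodesicDrift 0 (x, p)).1 = _
    rw [sub_zero, geodesicDrift_zero]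
  rw [← hut, hconst, hu0]

/-- **`π(τ) = e^{τA} π`**: the momentum component is the same rotation applied to the momentum (both
sides are the derivative of `τ ↦ x(τ) = e^{τA} x`, and `A` commutes with `e^{τA}`). -/
theorem geodesicDrift_snd_eq_exp (hx : ‖x‖ = 1) (hxp : ⟪x, p⟫_ℝ = 0) (t : ℝ) :
    (geodesicDrift t (x, p)).2 = exp (t • geodGen x p) p := by
  set A := geodGen x p with hA
  have h1 : HasDerivAt (fun s : ℝ => (geodesicDrift s (x, p)).1) (geodesicDrift t (x, p)).2 t :=
    hasDerivAt_geodesicDrift_fst x p t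
  have h2 : HasDerivAt (fun s : ℝ => exp (s • A) x) ((A * exp (t • A)) x) t :=
    ((hasDerivAt_exp_smul_const' (𝕂 := ℝ) A t).clm_apply (hasDerivAt_const t x)).congr_deriv (by simp)
  have hfun : (fun s : ℝ => (geodesicDrift s (x, p)).1) = fun s => exp (s • A) x :=
    funext fun s => geodesicDrift_fst_eq_exp hx hxp s
  rw [hfun] at h1
  have hcomm : A * exp (t • A) = exp (t • A) * A := (((Commute.refl A).smul_right t).exp_right).eq
  rw [h1.unique h2, hcomm]
  show exp (t • A) (A x) = _
  rw [hA, geodGen_apply_self hx hxp]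

/-- **THE EXACT GEODESIC DRIFT IS THE EXPONENTIAL OF THE ROTATION GENERATOR**:
`geodesicDrift τ (x, π) = (e^{τA} x, e^{τA} π)`, `A = A(x, π)`, for `‖x‖ = 1`, `⟪x, π⟫ = 0`. -/
theorem geodesicDrift_eq_exp (hx : ‖x‖ = 1) (hxp : ⟪x, p⟫_ℝ = 0) (t : ℝ) :
    geodesicDrift t (x, p) = (exp (t • geodGen x p) x, exp (t • geodGen x p) p) :=
  Prod.ext (geodesicDrift_fst_eq_exp hx hxp t) (geodesicDrift_snd_eq_exp hx hxp t)

end Exp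

end Summit.Ventures.LatticeQCDFlow.Exactness
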